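import Summits.QuantumFields.BalabanUV.Beta.EriceRemainderEnclosureHistoryAutonomyComparisonAgeCompositionOldTripleLeaf

/-!
# EriceRemainderEnclosureHistoryAutonomyComparisonAgeCompositionOldTripleLeafZero — (E103d) route (N), first order: THE LEAF OF THE OLD-TRIPLE CAP WITH
# SPLIT RATIO ZERO.  (E103c) `old_triple_leaf` reads the first `T = ⌊θ·age⌋` levels of each stretch by the ray and asks `θ ≥ 1∕56` (so that
# `(θ − 1∕56)·age ≤ T`); when two of the three ages are NEAR (`k∕j` or `n∕k` close to `1`) the stretch is short and the right split is `T = 0` (all of it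
# by the floor).  This file re-states the leaf with the split condition `θlo = 0 ∨ θlo·56 + 1 ≤ θ·56`, `0 ≤ θlo ≤ θ` (**`split_data₀`**,
# **`old_triple_leaf₀`**) — the form every cell table of the sequels uses (generator `HOME/b2b-balaban-beta-d4-p2/g89/numerics/cert_triple2.py`: at
# `V ≈` LP value `+ 0.11` the cells `(k∕j, n∕k) ∈ (1,2]², (1,2]×(2,3], (2,3]², (3,4]², (2,3]×(4,8], (4,8]²` take `68, 56, 43, 42, 58, 137` boxes).

Cell `pub-balaban`, β-function sub-cell, BINDER row D4 «RemainderConst leaves for Bałaban's split» (`HOME/BINDER-OWNERS.md`; owner lineage `b2b-balaban-beta-an4`;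
this file by co-owner #2 lineage `b2b-balaban-beta-d4-p2`, generation 89), β-FLOW TEAM duty (1), FREEZE (0) honoured (def-free; nothing restated).

HONEST FRAMING (page 1, verbatim and binding).  *"Discharging BetaPertH makes Bałaban's UV stability UNCONDITIONAL — a real constructive-QFT result; it is
NOT the continuum limit and NOT the Clay problem."*  THIS FILE DISCHARGES NOTHING OF THE KIND.  Elementary real algebra ∕ real analysis about ABSTRACT
functionals on a box ]0,γ]^ℕ with displayed floors, profiles and signs, and the FIRST-ORDER renewal objects of route (N) built from them — hypotheses of a
census, not facts; the form, signs, ages and moments of Bałaban's (1.22) limit functional are NOT PRINTED ([I] p. 298; GAPS G-t4-U2-1∕-2) and NOT asserted.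
Row D4 class UNCHANGED (critical-path width 0; instance 0∕1; D4 DISCHARGE NO DATE).  HONEST DEPENDENCY: continuum YM on T⁴ ⇐ BetaPertH ∧ nine spine
estimates (0/9 proved); BetaPertH ⇐ (D1) ∧ (D4) ∧ CAP+tail; G-an2-4 gates asym, D1 and NE2/3/4.

THE POINT (README `HOME/b2b-balaban-beta-d4-p2/g89/README.md` §3).  Uses (E103c) `own_const_56`, `far_const`, (E103a) letters and geometry, (E103b) `old_triple_box`
BY NAME.  NOT CLAIMED: any table (sequels); anything printed — NOT B12 Thm 2, NOT BetaPertH, NOT continuum, NOT Clay.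

WHAT IS PROVED ([folklore]; 0 `def`, 0 sorry).  §1 **`split_data₀`**, **`old_triple_leaf₀`**.
-/
noncomputable section
open Finset

namespace Summit.QuantumFields.BalabanUV.Beta.EriceRemainderEnclosureHistoryAutonomyComparisonAgeCompositionOldTripleLeafZero

open Literature.MathematicalPhysics.QuantumFieldTheory.Balaban1983to89
open Literature.MathematicalPhysics.QuantumFieldTheory.Balaban1983to89.T4BetaStationary
open Literature.MathematicalPhysics.QuantumFieldTheory.Balaban1983to89.T4BetaFlowWellPosed
open Summit.QuantumFields.BalabanUV.Beta.EriceRemainderEnclosureHistoryAutonomyComparisonAgeCompositionOldTripleLetters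
  (triple_sigma_bounds triple_letter_young triple_letter_mid triple_letter_old)
open Summit.QuantumFields.BalabanUV.Beta.EriceRemainderEnclosureHistoryAutonomyComparisonAgeCompositionTripleBox (old_triple_box)
open Summit.QuantumFields.BalabanUV.Beta.EriceRemainderEnclosureHistoryAutonomyComparisonAgeCompositionOldTripleLeaf (own_const_56 far_const)

variable {B : (ℕ → ℝ) → ℝ} {γ b gIR : ℝ} {L : ℕ → ℝ} {K : ℕ} {h : ℕ → ℝ}

/-! ## §1 The certified leaf with split ratio zero allowed -/

/-- **THE SPLIT DATA OF A BOX, ZERO ALLOWED.**  A young age `u ≥ 56` (real) with `Fl·u ≤ w`, a split ratio `0 ≤ θlo ≤ θ` with `θlo = 0` or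
`θlo·56 + 1 ≤ θ·56`, `θ + 1 ≤ Fl`, and a ray constant with `c_T²(2+θ+1∕56) ≤ 2`: `T = ⌊θu⌋` satisfies `θlo·u ≤ T ≤ θ·u`, `T + u ≤ w`,
`c_T²(2u+T+1) ≤ 2u`. [folklore] -/
theorem split_data₀ {u w θ θlo Fl cT : ℝ} (hu : 56 ≤ u) (hw : Fl * u ≤ w) (hθlo : 0 ≤ θlo) (hθle : θlo ≤ θ) (hθ : θlo = 0 ∨ θlo * 56 + 1 ≤ θ * 56)
    (hθF : θ + 1 ≤ Fl) (hcT : cT ^ 2 * (2 + θ + 1 / 56) ≤ 2) :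
    θlo * u ≤ (⌊θ * u⌋₊ : ℕ) ∧ ((⌊θ * u⌋₊ : ℕ) : ℝ) ≤ θ * u ∧ ((⌊θ * u⌋₊ : ℕ) : ℝ) + u ≤ w
      ∧ cT ^ 2 * (2 * u + (⌊θ * u⌋₊ : ℕ) + 1) ≤ 2 * u := by
  have hupos : 0 < u := by linarith
  have hθ0 : 0 ≤ θ := le_trans hθlo hθle
  have hθu : 0 ≤ θ * u := by positivity
  have hTle : ((⌊θ * u⌋₊ : ℕ) : ℝ) ≤ θ * u := Nat.floor_le hθu
  have hTgt : θ * u < ((⌊θ * u⌋₊ : ℕ) : ℝ) + 1 := Nat.lt_floor_add_one _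
  refine ⟨?_, hTle, by nlinarith, ?_⟩
  · rcases hθ with h0 | hgap
    · rw [h0, zero_mul]; exact Nat.cast_nonneg _
    · have : 1 ≤ (θ - θlo) * u := by nlinarith
      linarith
  · have h1 : 2 * u + ((⌊θ * u⌋₊ : ℕ) : ℝ) + 1 ≤ u * (2 + θ + 1 / 56) := by nlinarith
    calc cT ^ 2 * (2 * u + ((⌊θ * u⌋₊ : ℕ) : ℝ) + 1) ≤ cT ^ 2 * (u * (2 + θ + 1 / 56)) := mul_le_mul_of_nonneg_left h1 (sq_nonneg _)
      _ = u * (cT ^ 2 * (2 + θ + 1 / 56)) := by ring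
      _ ≤ u * 2 := mul_le_mul_of_nonneg_left hcT hupos.le
      _ = 2 * u := by ring

/-- **THE LEAF OF THE OLD-TRIPLE CAP, SPLIT RATIO ZERO ALLOWED.**  As (E103c) `old_triple_leaf` with the split conditions of `split_data₀`.  `B` an isotone memory with floor `b > 0` dominating `L ≥ 0`, `h` a box solution, old ages `56 ≤ j < k < n < K` in
the box `F₁l·j ≤ k ≤ F₁h·j`, `F₂l·k ≤ n ≤ F₂h·k`, `σ₁ = h_{m+j}∕h_{m+k} ∈ [s₁l, s₁h]`, `σ₂ = h_{m+k}∕h_{m+n} ∈ [s₂l, s₂h]` (or the pin-ray forms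
`F₁h ≤ s₁h²`, `F₂h ≤ s₂h²`), and rational data passing the side conditions of the module docstring.  THEN `x_j(m) + x_k(m) + x_n(m) ≤ V`. [folklore] -/
theorem old_triple_leaf₀ (hmono : ∀ u v : ℕ → ℝ, SeqBox γ u → SeqBox γ v → (∀ j, u j ≤ v j) → B u ≤ B v)
    (hL : ∀ k, 0 ≤ L k) (hb : 0 < b) (hlo : ∀ u, SeqBox γ u → b ≤ B u) (hdom : ∀ u, SeqBox γ u → ∑ k ∈ range K, L k * u k ≤ B u)
    (hh : SeqBox γ h) (hf : MemFlow B gIR h) {j k n : ℕ} (h56 : 56 ≤ j) (hjk : j < k) (hkn : k < n) (hnK : n < K) (m : ℕ)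
    {F₁l F₁h F₂l F₂h s₁l s₁h s₂l s₂h θ₁ θ₁lo θ₂ θ₂lo θ₃ θ₃lo cT₁ cT₂ cT₃ c₁ c₂ c₃ Jz Jy Kx₁ Jy₂ Kx₂ Kz l₁ l₂ l₃ V : ℝ}
    (hk1 : F₁l * j ≤ k) (hk2 : (k : ℝ) ≤ F₁h * j) (hn1 : F₂l * k ≤ n) (hn2 : (n : ℝ) ≤ F₂h * k)
    (hσ₁l : s₁l ≤ h (m + j) / h (m + k)) (hσ₁h : h (m + j) / h (m + k) ≤ s₁h ∨ F₁h ≤ s₁h ^ 2)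
    (hσ₂l : s₂l ≤ h (m + k) / h (m + n)) (hσ₂h : h (m + k) / h (m + n) ≤ s₂h ∨ F₂h ≤ s₂h ^ 2)
    (hnum : (0 < s₁l ∧ 0 < s₁h ∧ 0 < s₂l ∧ 0 < s₂h)
      ∧ (0 ≤ θ₁lo ∧ θ₁lo ≤ θ₁ ∧ (θ₁lo = 0 ∨ θ₁lo * 56 + 1 ≤ θ₁ * 56) ∧ θ₁ + 1 ≤ F₁l ∧ 0 ≤ cT₁ ∧ cT₁ ^ 2 * (2 + θ₁ + 1 / 56) ≤ 2)
      ∧ (0 ≤ θ₂lo ∧ θ₂lo ≤ θ₂ ∧ (θ₂lo = 0 ∨ θ₂lo * 56 + 1 ≤ θ₂ * 56) ∧ θ₂ + 1 ≤ F₁l * F₂l ∧ 0 ≤ cT₂ ∧ cT₂ ^ 2 * (2 + θ₂ + 1 / 56) ≤ 2)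
      ∧ (0 ≤ θ₃lo ∧ θ₃lo ≤ θ₃ ∧ (θ₃lo = 0 ∨ θ₃lo * 56 + 1 ≤ θ₃ * 56) ∧ θ₃ + 1 ≤ F₂l ∧ 0 ≤ cT₃ ∧ cT₃ ^ 2 * (2 + θ₃ + 1 / 56) ≤ 2)
      ∧ (0 ≤ c₁ ∧ c₁ ^ 2 * (2 * F₁l + 57 / 56) ≤ 2 * F₁l ∧ 0 ≤ c₂ ∧ c₂ ^ 2 * (2 * (F₁l * F₂l) + 57 / 56) ≤ 2 * (F₁l * F₂l)
          ∧ 0 ≤ c₃ ∧ c₃ ^ 2 * (2 * F₂l + 57 / 56) ≤ 2 * F₂l)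
      ∧ (Jz ≤ 2 * c₁ * s₁l ^ 2 / F₁h ∧ Jy ≤ 2 * c₂ * (s₁l * s₂l) ^ 2 / (F₁h * F₂h)
          ∧ Kx₁ ≤ 2 * cT₁ * θ₁lo / s₁h ^ 2 + 2 * (F₁l - 1 - θ₁ + c₁) / s₁h ^ 3 ∧ Jy₂ ≤ 2 * c₃ * s₂l ^ 2 / F₂h
          ∧ Kx₂ ≤ 2 * cT₂ * θ₂lo / (s₁h * s₂h) ^ 2 + 2 * (F₁l * F₂l - 1 - θ₂ + c₂) / (s₁h * s₂h) ^ 3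
          ∧ Kz ≤ 2 * cT₃ * θ₃lo / s₂h ^ 2 + 2 * (F₂l - 1 - θ₃ + c₃) / s₂h ^ 3)
      ∧ (0 ≤ l₁ ∧ 0 ≤ l₂ ∧ 0 ≤ l₃ ∧ 1 ≤ l₁ * (2 * (407 / 500)) + l₂ * Kx₁ + l₃ * Kx₂ ∧ 1 ≤ l₁ * Jz + l₂ * (2 * (407 / 500)) + l₃ * Kz
          ∧ 1 ≤ l₁ * Jy + l₂ * Jy₂ + l₃ * (2 * (407 / 500)) ∧ l₁ + l₂ + l₃ ≤ V)) :
    (j : ℝ) * (L j * h (m + j) ^ 3 / 2) + (k : ℝ) * (L k * h (m + k) ^ 3 / 2) + (n : ℝ) * (L n * h (m + n) ^ 3 / 2) ≤ V := by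
  obtain ⟨⟨hs₁l, hs₁h, hs₂l, hs₂h⟩, ⟨hθ₁lo, hθ₁le, hθ₁, hθ₁F, hcT₁0, hcT₁⟩, ⟨hθ₂lo, hθ₂le, hθ₂, hθ₂F, hcT₂0, hcT₂⟩, ⟨hθ₃lo, hθ₃le, hθ₃, hθ₃F, hcT₃0, hcT₃⟩,
    ⟨hc₁0, hc₁, hc₂0, hc₂, hc₃0, hc₃⟩, ⟨hJz, hJy, hKx₁, hJy₂, hKx₂, hKz⟩, ⟨hl₁, hl₂, hl₃, hcx, hcz, hcy, hV⟩⟩ := hnum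
  have hpos : ∀ n, 0 < h n := fun n => (hh n).1
  have hjr : (56 : ℝ) ≤ j := by exact_mod_cast h56
  have hjpos : (0 : ℝ) < j := by linarith
  have hkr : (56 : ℝ) ≤ k := le_trans hjr (by exact_mod_cast hjk.le)
  have hj1 : 1 ≤ j := by omega
  have hF₁l : 1 ≤ F₁l := by linarith
  have hF₂l : 1 ≤ F₂l := by linarith
  have hnj : F₁l * F₂l * j ≤ n :=
    calc F₁l * F₂l * j = F₂l * (F₁l * j) := by ring
      _ ≤ F₂l * k := mul_le_mul_of_nonneg_left hk1 (by linarith)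
      _ ≤ n := hn1
  have hc₀ := own_const_56 hjr
  -- the three splits and the far constants
  obtain ⟨hT₁l, hT₁h, hT₁w, hcT₁'⟩ := split_data₀ hjr hk1 hθ₁lo hθ₁le hθ₁ hθ₁F hcT₁
  obtain ⟨hT₂l, hT₂h, hT₂w, hcT₂'⟩ := split_data₀ hjr hnj hθ₂lo hθ₂le hθ₂ hθ₂F hcT₂
  obtain ⟨hT₃l, hT₃h, hT₃w, hcT₃'⟩ := split_data₀ hkr hn1 hθ₃lo hθ₃le hθ₃ hθ₃F hcT₃
  have hc₁' : c₁ ^ 2 * (2 * (k : ℝ) + j + 1) ≤ 2 * k := far_const hjr hk1 (by linarith) hc₁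
  have hc₂' : c₂ ^ 2 * (2 * (n : ℝ) + j + 1) ≤ 2 * n := far_const hjr hnj (mul_pos (by linarith) (by linarith)) hc₂
  have hc₃' : c₃ ^ 2 * (2 * (n : ℝ) + k + 1) ≤ 2 * n := far_const hkr hn1 (by linarith) hc₃
  have hT₁k : ⌊θ₁ * (j : ℝ)⌋₊ + j ≤ k := by exact_mod_cast hT₁w
  have hT₂n : ⌊θ₂ * (j : ℝ)⌋₊ + j ≤ n := by exact_mod_cast hT₂w
  have hT₃n : ⌊θ₃ * (k : ℝ)⌋₊ + k ≤ n := by exact_mod_cast hT₃w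
  -- the letters and the geometry
  have hWj := triple_letter_young hmono hL hb hlo hdom hh hf hj1 hjk hkn hnK hc₀ hc₁' hc₂' m
  have hWk := triple_letter_mid hmono hL hb hlo hdom hh hf hj1 hjk hkn hnK hT₁k hc₀ hc₁' hc₃' hcT₁' m
  have hWn := triple_letter_old hmono hL hb hlo hdom hh hf hj1 hjk hkn hnK hT₂n hT₃n hc₀ hc₂' hc₃' hcT₂' hcT₃' m
  obtain ⟨hs1, hs2, hr1, hr2, -⟩ := triple_sigma_bounds hmono hL hb hlo hdom hh hf hj1 hjk hkn hnK m
  have hσ₁0 : 0 < h (m + j) / h (m + k) := lt_of_lt_of_le one_pos hs1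
  have hσ₂0 : 0 < h (m + k) / h (m + n) := lt_of_lt_of_le one_pos hs2
  have hkpos : (0 : ℝ) < k := by linarith
  have hσ₁h' : h (m + j) / h (m + k) ≤ s₁h := by
    rcases hσ₁h with h2 | h2
    · exact h2
    · have h3 : (h (m + j) / h (m + k)) ^ 2 * j ≤ s₁h ^ 2 * j :=
        le_trans hr1 (le_trans hk2 (mul_le_mul_of_nonneg_right h2 hjpos.le))
      exact (pow_le_pow_iff_left₀ hσ₁0.le hs₁h.le two_ne_zero).mp (le_of_mul_le_mul_right h3 hjpos)
  have hσ₂h' : h (m + k) / h (m + n) ≤ s₂h := by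
    rcases hσ₂h with h2 | h2
    · exact h2
    · have h3 : (h (m + k) / h (m + n)) ^ 2 * k ≤ s₂h ^ 2 * k :=
        le_trans hr2 (le_trans hn2 (mul_le_mul_of_nonneg_right h2 hkpos.le))
      exact (pow_le_pow_iff_left₀ hσ₂0.le hs₂h.le two_ne_zero).mp (le_of_mul_le_mul_right h3 hkpos)
  have hx : 0 ≤ (j : ℝ) * (L j * h (m + j) ^ 3 / 2) := by have := hL j; have := hpos (m + j); positivity
  have hz : 0 ≤ (k : ℝ) * (L k * h (m + k) ^ 3 / 2) := by have := hL k; have := hpos (m + k); positivity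
  have hy : 0 ≤ (n : ℝ) * (L n * h (m + n) ^ 3 / 2) := by have := hL n; have := hpos (m + n); positivity
  exact old_triple_box hx hz hy (by norm_num : (0 : ℝ) < 56) hjr hk1 hk2 hn1 hn2 hF₁l hF₂l hσ₁l hσ₁h' hσ₂l hσ₂h' hs₁l hs₂l
    hT₁l hT₁h hT₂l hT₂h hT₃l hT₃h hθ₁lo hθ₂lo hθ₃lo hθ₁F hθ₂F hθ₃F hc₁0 hc₂0 hc₃0 hcT₁0 hcT₂0 hcT₃0 hWj hWk hWn
    hJz hJy hKx₁ hJy₂ hKx₂ hKz hl₁ hl₂ hl₃ hcx hcz hcy hV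

end Summit.QuantumFields.BalabanUV.Beta.EriceRemainderEnclosureHistoryAutonomyComparisonAgeCompositionOldTripleLeafZero
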